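import Summits.QuantumFields.YangMills.Theorems.SwapVirialDeficitSectorLaplaceTipWindowReading
import Summits.QuantumFields.YangMills.Theorems.SwapVirialDeficitSectorLaplaceTipRates
import Summits.QuantumFields.YangMills.Theorems.SwapVirialDeficitSectorLaplaceEndGaussPlugTail
import HarnessLib

/-!
# THE TIP OF SKELETON ➎: `stub_core_tip` FROM TWO HALF-WINDOW BOUNDS IN THE LETTER `δ` (the tip plug, layer 1 of 2)
# (cell ym-idea-1; free-hands support of ⟨stmt-QuantumFields-24197⟩ `SwapVirialDeficit.SwapGluedStiffness`; LEAD g99 ruling 2026-09-01 00:37Z «sockets first»;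
# w2 g60 ✓`stub_core_tip_of_tipBound`, w3 g68 ✓`tipWindow_eq_integral_hubIntegral`)

The tip window `{(1+δ²)⁻¹ < τ}` of `hT` (✓`stub_core_tip_of_tipBound`) is, in the letter `δ = re a∕‖im a‖`, the union of the two apices `δ → +∞` (seam `c → +1`)
and `δ → −∞` (`c → −1`).  This file reduces `stub_core_tip` to ONE bound per half-window in the TWO-RATE normal form of ✓`core_of_two_rates` plus an
`e^{−√b}`-type tail (the shape the producers deliver: w3 g68 ✓`tipMid_window_le` ∕ ✓`tipMid_le_shell_of_pointwise` ∕ ✓`shell_boxMass_le_mbMain`, w2 g61's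
comparability, the tip-core and the corner ∕ ends estimates):
* §1 `tipTail_le` — the tail `e^{CT·L^pT − √b·τ^qT∕(QT·L^pT)}` is at most `(1∕256)·(2π∕b)^α·M_ε` above a polynomial threshold (✓`tail_absorb`);
* §2 `tipWindow_split` — `{(1+δ²)⁻¹ < τ} = {… ∧ 0 < δ} ∪ {… ∧ δ < 0}` (`τ ≤ 1`), and the window integral splits;
* §3 ★★★ `tipBound_of_halves (h₊) (h₋) : hT` and ★★★ `stub_core_tip_of_halves (h₊) (h₋) : <stub_core_tip of ➎ v14 VERBATIM>` — budgets `4 × 1∕256 = 1∕64`.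
The HALF SOCKET (positive; the negative one has `δ < 0`): `∃ C>0 c γ>0 D≥0 d d′ η>0 CT pT QT>0 qT K₁>0 k₁ τw>0 kw, ∀ L τ (0<τ≤τw∕L^kw) b (K₁L^k₁τ⁻¹^k₁ ≤ b) ε good,
κ_L·(coneConst·π·∫_{(1+δ²)⁻¹<τ ∧ 0<δ} ((1+δ²)⁻¹)²·I(hubAt δ 1, ε; b) dδ) ≤ (C·L^c·τ^γ + D·L^d·τ⁻¹^{d′}·b^{−η})·((2π∕b)^α·M_ε) + e^{CT·L^pT − √b·τ^qT∕(QT·L^pT)}`.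
Layer 2 (`halfBound_pos_of_pieces`, sockets hMidBox ∕ hMidCompl ∕ hCore) composes the positive half from the producers' bricks.

HONEST LABEL: bookkeeping; the half bounds, `stub_core_tip`, ⟨24197⟩ ∕ ⟨24194⟩ are OPEN; item of record ⟨24085⟩ `SubOctaveBounded` aside ∕ untouched; the Yang–Mills
mass gap is NOT proved; no summit is proved by a line.  THEOREMS ONLY (0 `def`, 0 `sorry`), standard axioms, no instances.  Seat ym-line-fcl-p3 g49 (cell ym-idea-1,
free hands = ➎ assembler), `--supports stmt-QuantumFields-24197`.  References: [cite: Luscher1983, §2]; [folklore].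
-/

set_option autoImplicit false
set_option synthInstance.maxSize 1024

noncomputable section

open MeasureTheory Quaternion Set Module
open scoped Quaternion BigOperators ENNReal
open Literature.MathematicalPhysics.QuantumLattice
open Literature.MathematicalPhysics.QuantumFieldTheory hiding SU2
open Summit.QuantumFields.YangMills.Theorems.SwapTwistDeficit.ToronLog

namespace Summit.QuantumFields.YangMills.Theorems.SwapVirialDeficit.SectorLaplace

open Summit.QuantumFields.YangMills.Theorems.FemtoTransferGap
open Summit.QuantumFields.YangMills.Theorems.FemtoTransferGap.TT
open Summit.QuantumFields.YangMills.Theorems.VirialFluxGap.RingDeficit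
open Summit.QuantumFields.YangMills.Theorems.SwapVirialDeficit.SwapRing
open Summit.QuantumFields.YangMills.Theorems.SwapVirialDeficit.BlowUpRing

variable {L : ℕ} [NeZero L]

/-! ## §1 The `e^{−√b}` tail -/

set_option maxHeartbeats 400000 in
/-- ★ **THE TIP TAIL IS ABSORBED**: for tail constants `CT`, `QT > 0`, `pT`, `qT` there are `K_T > 0`, `k_T` with
`e^{CT·L^pT − √b·τ^qT∕(QT·L^pT)} ≤ (1∕256)·((2π∕b)^α·M_ε)` for good `ε`, `0 < τ ≤ ½`, `b ≥ K_T·L^{k_T}·τ⁻¹^{k_T}`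
(✓`tail_absorb` with `κ = 1`, `Kc = KcB = (coneConst·π)⁻¹`, `Sg = 1`; `b^{1∕4} ≥ Y` from `Y⁴ ≤ b`). [folklore] -/
theorem tipTail_le (CT : ℝ) {QT : ℝ} (hQT : 0 < QT) (pT qT : ℕ) :
    ∃ KT : ℝ, 0 < KT ∧ ∃ kT : ℕ, ∀ (L : ℕ) [NeZero L] (ε : GnoSign L), GoodSign ε → ∀ τ : ℝ, 0 < τ → τ ≤ 1 / 2 →
      ∀ b : ℝ, KT * (L : ℝ) ^ kT * τ⁻¹ ^ kT ≤ b →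
        Real.exp (CT * (L : ℝ) ^ pT - Real.sqrt b * τ ^ qT / (QT * (L : ℝ) ^ pT)) ≤
          (1 / 256 : ℝ) * ((2 * Real.pi / b) ^ alpha L * ∫ a in HubBulk τ, (∫ p : ℝ × ℝ, mbDensity (L := L) a ε p) ∂coneMeasure) := by
  obtain ⟨cH, hcH⟩ : ∃ cH : ℝ, cH = coneMeasure.real (HubBulk (1 / 2)) := ⟨_, rfl⟩
  obtain ⟨W₀, hW₀⟩ : ∃ W₀ : ℝ, W₀ = 40 + |Real.log cH| + 183602 + 6 + 9 * 46 + |CT| := ⟨_, rfl⟩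
  have hW₀0 : 0 ≤ W₀ := by rw [hW₀]; positivity
  refine ⟨(1 + W₀ * QT) ^ 4, by positivity, 4 * (8 + 2 * pT) + 4 * qT, fun L _ ε hε τ hτ hτ2 b hb => ?_⟩
  have hL1 : (1 : ℝ) ≤ L := by exact_mod_cast NeZero.one_le
  have hL0 : (0 : ℝ) < L := by linarith
  have hτ1 : τ ≤ 1 := by linarith
  have hτi1 : 1 ≤ τ⁻¹ := by rw [one_le_inv₀ hτ]; exact hτ1
  have hcc : 0 < coneConst * Real.pi := mul_pos coneConst_pos Real.pi_pos
  -- thresholds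
  have hKT1 : (1 : ℝ) ≤ (1 + W₀ * QT) ^ 4 := one_le_pow₀ (by nlinarith [mul_nonneg hW₀0 hQT.le])
  have hb1 : 1 ≤ b := by
    calc (1 : ℝ) = 1 * 1 * 1 := by ring
      _ ≤ (1 + W₀ * QT) ^ 4 * (L : ℝ) ^ (4 * (8 + 2 * pT) + 4 * qT) * τ⁻¹ ^ (4 * (8 + 2 * pT) + 4 * qT) :=
          mul_le_mul (mul_le_mul hKT1 (one_le_pow₀ hL1) zero_le_one (by positivity)) (one_le_pow₀ hτi1) zero_le_one (by positivity)
      _ ≤ b := hb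
  have hb0 : 0 < b := by linarith
  obtain ⟨Y, hY⟩ : ∃ Y : ℝ, Y = W₀ * QT * (L : ℝ) ^ (8 + 2 * pT) * τ⁻¹ ^ qT := ⟨_, rfl⟩
  have hY0 : 0 ≤ Y := by rw [hY]; positivity
  have hY4b : Y ^ 4 ≤ b := by
    refine le_trans ?_ hb
    have e : Y ^ 4 = (W₀ * QT) ^ 4 * (L : ℝ) ^ (4 * (8 + 2 * pT)) * τ⁻¹ ^ (4 * qT) := by rw [hY]; ring
    rw [e]
    have h1 : (W₀ * QT) ^ 4 ≤ (1 + W₀ * QT) ^ 4 := pow_le_pow_left₀ (mul_nonneg hW₀0 hQT.le) (by linarith) 4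
    exact mul_le_mul (mul_le_mul h1 (pow_le_pow_right₀ hL1 (by omega)) (by positivity) (by positivity))
      (pow_le_pow_right₀ hτi1 (by omega)) (by positivity) (by positivity)
  have hYb : Y ≤ b ^ (1 / 4 : ℝ) := by
    have h1 : (Y ^ 4) ^ (1 / 4 : ℝ) ≤ b ^ (1 / 4 : ℝ) := Real.rpow_le_rpow (by positivity) hY4b (by norm_num)
    have h2 : (Y ^ 4) ^ (1 / 4 : ℝ) = Y := by
      rw [← Real.rpow_natCast Y 4, ← Real.rpow_mul hY0]; norm_num
    rw [h2] at h1; exact h1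
  -- the threshold of `tail_absorb` with `X = √b·τ^qT/(QT·L^pT)`
  have hW : 4 * (9 * (L : ℝ) ^ 4 + 1) + (|Real.log (coneMeasure.real (HubBulk (1 / 2)))| + 183602 * (L : ℝ) ^ 8 +
      (6 + 9 * (L : ℝ) ^ 4 * (coneConst * Real.pi) * (coneConst * Real.pi)⁻¹ * 46 + |CT| * (L : ℝ) ^ pT)) ≤ W₀ * (L : ℝ) ^ (8 + pT) := by
    rw [← hcH, hW₀, mul_inv_cancel_right₀ hcc.ne']
    have hLp : (1 : ℝ) ≤ (L : ℝ) ^ (8 + pT) := one_le_pow₀ hL1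
    have hL4le : (L : ℝ) ^ 4 ≤ (L : ℝ) ^ (8 + pT) := pow_le_pow_right₀ hL1 (by omega)
    have hL8le : (L : ℝ) ^ 8 ≤ (L : ℝ) ^ (8 + pT) := pow_le_pow_right₀ hL1 (by omega)
    have hLple : (L : ℝ) ^ pT ≤ (L : ℝ) ^ (8 + pT) := pow_le_pow_right₀ hL1 (by omega)
    have a1 := abs_nonneg (Real.log cH)
    have a2 := abs_nonneg CT
    nlinarith [mul_le_mul_of_nonneg_left hLp a1, mul_le_mul_of_nonneg_left hLple a2, mul_le_mul_of_nonneg_left hL4le (by norm_num : (0:ℝ) ≤ 36),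
      mul_le_mul_of_nonneg_left hL4le (by norm_num : (0:ℝ) ≤ 9 * 46), mul_le_mul_of_nonneg_left hL8le (by norm_num : (0:ℝ) ≤ 183602)]
  have hX : b ^ (1 / 4 : ℝ) * (4 * (9 * (L : ℝ) ^ 4 + 1) + (|Real.log (coneMeasure.real (HubBulk (1 / 2)))| + 183602 * (L : ℝ) ^ 8 +
      (6 + 9 * (L : ℝ) ^ 4 * (coneConst * Real.pi) * (coneConst * Real.pi)⁻¹ * 46 + |CT| * (L : ℝ) ^ pT))) ≤ Real.sqrt b * τ ^ qT / (QT * (L : ℝ) ^ pT) := by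
    have hq0 : 0 ≤ b ^ (1 / 4 : ℝ) := Real.rpow_nonneg hb0.le _
    have hsplit : Real.sqrt b = b ^ (1 / 4 : ℝ) * b ^ (1 / 4 : ℝ) := by rw [← Real.rpow_add hb0, Real.sqrt_eq_rpow]; norm_num
    have hkey : W₀ * (L : ℝ) ^ (8 + pT) ≤ b ^ (1 / 4 : ℝ) * (τ ^ qT / (QT * (L : ℝ) ^ pT)) := by
      rw [mul_div_assoc', le_div_iff₀ (by positivity)]
      have e : W₀ * (L : ℝ) ^ (8 + pT) * (QT * (L : ℝ) ^ pT) = Y * τ ^ qT := by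
        rw [hY]
        have hτq : τ⁻¹ ^ qT * τ ^ qT = 1 := by rw [← mul_pow, inv_mul_cancel₀ hτ.ne', one_pow]
        calc W₀ * (L : ℝ) ^ (8 + pT) * (QT * (L : ℝ) ^ pT) = W₀ * QT * (L : ℝ) ^ (8 + 2 * pT) * 1 := by ring
          _ = W₀ * QT * (L : ℝ) ^ (8 + 2 * pT) * (τ⁻¹ ^ qT * τ ^ qT) := by rw [hτq]
          _ = W₀ * QT * (L : ℝ) ^ (8 + 2 * pT) * τ⁻¹ ^ qT * τ ^ qT := by ring
      rw [e]
      exact mul_le_mul_of_nonneg_right hYb (by positivity)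
    calc b ^ (1 / 4 : ℝ) * _ ≤ b ^ (1 / 4 : ℝ) * (W₀ * (L : ℝ) ^ (8 + pT)) := mul_le_mul_of_nonneg_left hW hq0
      _ ≤ b ^ (1 / 4 : ℝ) * (b ^ (1 / 4 : ℝ) * (τ ^ qT / (QT * (L : ℝ) ^ pT))) := mul_le_mul_of_nonneg_left hkey hq0
      _ = Real.sqrt b * τ ^ qT / (QT * (L : ℝ) ^ pT) := by rw [← mul_assoc, ← hsplit]; ring
  have h := tail_absorb (L := L) hε hτ hτ2 (κ := 1) (Kc := (coneConst * Real.pi)⁻¹) (KcB := (coneConst * Real.pi)⁻¹) (Sg := 1) (CT := CT) (pT := pT)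
    hb1 (by nlinarith [one_le_pow₀ (n := 4) hL1]) (inv_nonneg.2 hcc.le) le_rfl zero_le_one (by norm_num) hX
  have e : (1 : ℝ) * (coneConst * Real.pi * ((coneConst * Real.pi)⁻¹ *
      (Real.exp (CT * (L : ℝ) ^ pT - Real.sqrt b * τ ^ qT / (QT * (L : ℝ) ^ pT)) * 1))) =
      Real.exp (CT * (L : ℝ) ^ pT - Real.sqrt b * τ ^ qT / (QT * (L : ℝ) ^ pT)) := by
    rw [one_mul, mul_one, ← mul_assoc, mul_inv_cancel₀ hcc.ne', one_mul]
  rw [e] at h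
  exact h

/-! ## §2 The window splits into the two apices -/

omit [NeZero L] in
/-- For `τ ≤ 1`: `{(1+δ²)⁻¹ < τ} = {(1+δ²)⁻¹ < τ ∧ 0 < δ} ∪ {(1+δ²)⁻¹ < τ ∧ δ < 0}` (`δ = 0` has `(1+0)⁻¹ = 1 ≥ τ`). [folklore] -/
theorem tipWindow_eq_union {τ : ℝ} (hτ1 : τ ≤ 1) :
    {δ : ℝ | (1 + δ ^ 2)⁻¹ < τ} = {δ : ℝ | (1 + δ ^ 2)⁻¹ < τ ∧ 0 < δ} ∪ {δ : ℝ | (1 + δ ^ 2)⁻¹ < τ ∧ δ < 0} := by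
  ext δ
  simp only [mem_setOf_eq, mem_union]
  constructor
  · intro h
    have hδ : δ ≠ 0 := by
      rintro rfl
      norm_num at h
      linarith
    rcases lt_or_gt_of_ne hδ with hlt | hgt
    · exact Or.inr ⟨h, hlt⟩
    · exact Or.inl ⟨h, hgt⟩
  · rintro (⟨h, -⟩ | ⟨h, -⟩) <;> exact h

omit [NeZero L] in
/-- The two apices are measurable and disjoint. [folklore] -/
theorem tipWindow_halves_measurable_disjoint (τ : ℝ) :
    MeasurableSet {δ : ℝ | (1 + δ ^ 2)⁻¹ < τ ∧ 0 < δ} ∧ MeasurableSet {δ : ℝ | (1 + δ ^ 2)⁻¹ < τ ∧ δ < 0} ∧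
      Disjoint {δ : ℝ | (1 + δ ^ 2)⁻¹ < τ ∧ 0 < δ} {δ : ℝ | (1 + δ ^ 2)⁻¹ < τ ∧ δ < 0} := by
  have hm : Measurable fun δ : ℝ => (1 + δ ^ 2)⁻¹ := (measurable_const.add (measurable_id.pow_const 2)).inv
  have hW : MeasurableSet {δ : ℝ | (1 + δ ^ 2)⁻¹ < τ} := measurableSet_lt hm measurable_const
  refine ⟨hW.inter (measurableSet_lt measurable_const measurable_id), hW.inter (measurableSet_lt measurable_id measurable_const), ?_⟩
  rw [Set.disjoint_left]
  rintro δ ⟨-, h1⟩ ⟨-, h2⟩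
  linarith

/-- ★ **THE TIP WINDOW INTEGRAL SPLITS** (`0 ≤ b`, `τ ≤ 1`; ✓`integrable_sqInv_mul_hubIntegral_hubAt`). [folklore] -/
theorem tipWindow_split (ε : GnoSign L) {τ : ℝ} (hτ1 : τ ≤ 1) {b : ℝ} (hb : 0 ≤ b) :
    ∫ δ in {δ : ℝ | (1 + δ ^ 2)⁻¹ < τ}, ((1 + δ ^ 2)⁻¹) ^ 2 * hubIntegral (L := L) (hubAt δ 1) ε b =
      (∫ δ in {δ : ℝ | (1 + δ ^ 2)⁻¹ < τ ∧ 0 < δ}, ((1 + δ ^ 2)⁻¹) ^ 2 * hubIntegral (L := L) (hubAt δ 1) ε b) +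
        ∫ δ in {δ : ℝ | (1 + δ ^ 2)⁻¹ < τ ∧ δ < 0}, ((1 + δ ^ 2)⁻¹) ^ 2 * hubIntegral (L := L) (hubAt δ 1) ε b := by
  obtain ⟨-, hB, hdisj⟩ := tipWindow_halves_measurable_disjoint τ
  have hI := integrable_sqInv_mul_hubIntegral_hubAt (L := L) ε hb
  rw [tipWindow_eq_union hτ1]
  exact setIntegral_union hdisj hB hI.integrableOn hI.integrableOn

/-! ## §3 ★★★ `hT` and `stub_core_tip` from the two half bounds -/

set_option maxHeartbeats 800000 in
/-- ★★★ **`hT` OF ✓`stub_core_tip_of_tipBound` FROM THE TWO HALF-WINDOW BOUNDS** (two-rate + tail sockets, one per apex): per half the rate part gets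
budget `1∕256` by ✓`core_of_two_rates` and the tail `1∕256` by ✓`tipTail_le`; `4 × 1∕256 = 1∕64`; thresholds merged. [cite: Luscher1983, §2] -/
theorem tipBound_of_halves
    (hpos : ∃ C : ℝ, 0 < C ∧ ∃ c : ℕ, ∃ γ : ℝ, 0 < γ ∧ ∃ D : ℝ, 0 ≤ D ∧ ∃ d d' : ℕ, ∃ η : ℝ, 0 < η ∧
      ∃ CT : ℝ, ∃ pT : ℕ, ∃ QT : ℝ, 0 < QT ∧ ∃ qT : ℕ, ∃ K₁ : ℝ, 0 < K₁ ∧ ∃ k₁ : ℕ, ∃ τw : ℝ, 0 < τw ∧ ∃ kw : ℕ,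
      ∀ (L : ℕ) [NeZero L] (τ : ℝ), 0 < τ → τ ≤ τw / (L : ℝ) ^ kw → ∀ b : ℝ, K₁ * (L : ℝ) ^ k₁ * τ⁻¹ ^ k₁ ≤ b → ∀ ε : GnoSign L, GoodSign ε →
        stiffKappa L (1 / 8) * (coneConst * Real.pi *
          ∫ δ in {δ : ℝ | (1 + δ ^ 2)⁻¹ < τ ∧ 0 < δ}, ((1 + δ ^ 2)⁻¹) ^ 2 * hubIntegral (L := L) (hubAt δ 1) ε b) ≤
          (C * (L : ℝ) ^ c * τ ^ γ + D * (L : ℝ) ^ d * τ⁻¹ ^ d' * b ^ (-η)) *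
              ((2 * Real.pi / b) ^ alpha L * ∫ a in HubBulk τ, (∫ p : ℝ × ℝ, mbDensity (L := L) a ε p) ∂coneMeasure) +
            Real.exp (CT * (L : ℝ) ^ pT - Real.sqrt b * τ ^ qT / (QT * (L : ℝ) ^ pT)))
    (hneg : ∃ C : ℝ, 0 < C ∧ ∃ c : ℕ, ∃ γ : ℝ, 0 < γ ∧ ∃ D : ℝ, 0 ≤ D ∧ ∃ d d' : ℕ, ∃ η : ℝ, 0 < η ∧
      ∃ CT : ℝ, ∃ pT : ℕ, ∃ QT : ℝ, 0 < QT ∧ ∃ qT : ℕ, ∃ K₁ : ℝ, 0 < K₁ ∧ ∃ k₁ : ℕ, ∃ τw : ℝ, 0 < τw ∧ ∃ kw : ℕ,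
      ∀ (L : ℕ) [NeZero L] (τ : ℝ), 0 < τ → τ ≤ τw / (L : ℝ) ^ kw → ∀ b : ℝ, K₁ * (L : ℝ) ^ k₁ * τ⁻¹ ^ k₁ ≤ b → ∀ ε : GnoSign L, GoodSign ε →
        stiffKappa L (1 / 8) * (coneConst * Real.pi *
          ∫ δ in {δ : ℝ | (1 + δ ^ 2)⁻¹ < τ ∧ δ < 0}, ((1 + δ ^ 2)⁻¹) ^ 2 * hubIntegral (L := L) (hubAt δ 1) ε b) ≤
          (C * (L : ℝ) ^ c * τ ^ γ + D * (L : ℝ) ^ d * τ⁻¹ ^ d' * b ^ (-η)) *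
              ((2 * Real.pi / b) ^ alpha L * ∫ a in HubBulk τ, (∫ p : ℝ × ℝ, mbDensity (L := L) a ε p) ∂coneMeasure) +
            Real.exp (CT * (L : ℝ) ^ pT - Real.sqrt b * τ ^ qT / (QT * (L : ℝ) ^ pT))) :
    ∃ K : ℝ, 0 < K ∧ ∃ k : ℕ, ∃ τ₀ : ℝ, 0 < τ₀ ∧ τ₀ ≤ 1 / 2 ∧ ∀ (L : ℕ) [NeZero L] (τ : ℝ), 0 < τ → τ ≤ τ₀ / (L : ℝ) ^ k →
      ∀ b : ℝ, K * (L : ℝ) ^ k * τ⁻¹ ^ k ≤ b → ∀ ε : GnoSign L, GoodSign ε →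
        stiffKappa L (1 / 8) * (coneConst * Real.pi *
          ∫ p in {p : ℝ × GnoCoord L | (1 + p.1 ^ 2)⁻¹ < τ},
              Real.exp (-(b * gnoDeficit z₀ (fun _ => 1) (hubAt p.1 1) ε p.2))
              ∂((volume : Measure (ℝ × GnoCoord L)).withDensity fun p => ENNReal.ofReal (((1 + p.1 ^ 2)⁻¹) ^ 2 * gnoDensity p.2))) ≤
          (1 / 64 : ℝ) * ((2 * Real.pi / b) ^ alpha L * ∫ a in HubBulk τ, (∫ p : ℝ × ℝ, mbDensity a ε p) ∂coneMeasure) := by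
  obtain ⟨C₁, hC₁, c₁, γ₁, hγ₁, D₁, hD₁, d₁, d₁', η₁, hη₁, CT₁, pT₁, QT₁, hQT₁, qT₁, K₁, hK₁, k₁, τw₁, hτw₁, kw₁, H₁⟩ := hpos
  obtain ⟨C₂, hC₂, c₂, γ₂, hγ₂, D₂, hD₂, d₂, d₂', η₂, hη₂, CT₂, pT₂, QT₂, hQT₂, qT₂, K₂, hK₂, k₂, τw₂, hτw₂, kw₂, H₂⟩ := hneg
  -- the two tails
  obtain ⟨KA, hKA, kA, HA⟩ := tipTail_le CT₁ hQT₁ pT₁ qT₁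
  obtain ⟨KB, hKB, kB, HB⟩ := tipTail_le CT₂ hQT₂ pT₂ qT₂
  -- the main term as a function of bare `L`
  set main : ∀ L : ℕ, ℝ → ℝ → GnoSign L → ℝ := fun L τ b ε =>
    if hL : L = 0 then 0 else
      haveI : NeZero L := ⟨hL⟩
      (2 * Real.pi / max b 1) ^ alpha L * ∫ a in HubBulk τ, (∫ p : ℝ × ℝ, mbDensity (L := L) a ε p) ∂coneMeasure with hmain
  have hmain0 : ∀ (L : ℕ) (τ b : ℝ) (ε : GnoSign L), 0 ≤ main L τ b ε := by
    intro L τ b ε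
    rw [hmain]
    simp only
    split_ifs with hL
    · exact le_rfl
    · haveI : NeZero L := ⟨hL⟩
      exact mul_nonneg (Real.rpow_nonneg (div_nonneg (by positivity) (le_trans zero_le_one (le_max_right _ _))) _)
        (setIntegral_nonneg (measurableSet_hubBulk τ) fun a _ => integral_nonneg fun p => mbDensity_nonneg a ε p)
  -- the two rate parts: `lhs := κ·(cc·π·∫_{half}) − tail`
  set lhs₁ : ∀ L : ℕ, ℝ → ℝ → GnoSign L → ℝ := fun L τ b ε =>
    if hL : L = 0 then 0 else
      haveI : NeZero L := ⟨hL⟩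
      stiffKappa L (1 / 8) * (coneConst * Real.pi *
          ∫ δ in {δ : ℝ | (1 + δ ^ 2)⁻¹ < τ ∧ 0 < δ}, ((1 + δ ^ 2)⁻¹) ^ 2 * hubIntegral (L := L) (hubAt δ 1) ε b) -
        Real.exp (CT₁ * (L : ℝ) ^ pT₁ - Real.sqrt b * τ ^ qT₁ / (QT₁ * (L : ℝ) ^ pT₁)) with hlhs₁
  set lhs₂ : ∀ L : ℕ, ℝ → ℝ → GnoSign L → ℝ := fun L τ b ε =>
    if hL : L = 0 then 0 else
      haveI : NeZero L := ⟨hL⟩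
      stiffKappa L (1 / 8) * (coneConst * Real.pi *
          ∫ δ in {δ : ℝ | (1 + δ ^ 2)⁻¹ < τ ∧ δ < 0}, ((1 + δ ^ 2)⁻¹) ^ 2 * hubIntegral (L := L) (hubAt δ 1) ε b) -
        Real.exp (CT₂ * (L : ℝ) ^ pT₂ - Real.sqrt b * τ ^ qT₂ / (QT₂ * (L : ℝ) ^ pT₂)) with hlhs₂
  have hmain_eq : ∀ (L : ℕ) [NeZero L] (τ b : ℝ) (ε : GnoSign L), 1 ≤ b →
      main L τ b ε = (2 * Real.pi / b) ^ alpha L * ∫ a in HubBulk τ, (∫ p : ℝ × ℝ, mbDensity (L := L) a ε p) ∂coneMeasure := by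
    intro L _ τ b ε hb1
    have h : main L τ b ε = (2 * Real.pi / max b 1) ^ alpha L * ∫ a in HubBulk τ, (∫ p : ℝ × ℝ, mbDensity (L := L) a ε p) ∂coneMeasure :=
      dif_neg (NeZero.ne L)
    rw [h, max_eq_left hb1]
  have hlhs₁_eq : ∀ (L : ℕ) [NeZero L] (τ b : ℝ) (ε : GnoSign L), lhs₁ L τ b ε =
      stiffKappa L (1 / 8) * (coneConst * Real.pi *
          ∫ δ in {δ : ℝ | (1 + δ ^ 2)⁻¹ < τ ∧ 0 < δ}, ((1 + δ ^ 2)⁻¹) ^ 2 * hubIntegral (L := L) (hubAt δ 1) ε b) -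
        Real.exp (CT₁ * (L : ℝ) ^ pT₁ - Real.sqrt b * τ ^ qT₁ / (QT₁ * (L : ℝ) ^ pT₁)) := fun L _ τ b ε => dif_neg (NeZero.ne L)
  have hlhs₂_eq : ∀ (L : ℕ) [NeZero L] (τ b : ℝ) (ε : GnoSign L), lhs₂ L τ b ε =
      stiffKappa L (1 / 8) * (coneConst * Real.pi *
          ∫ δ in {δ : ℝ | (1 + δ ^ 2)⁻¹ < τ ∧ δ < 0}, ((1 + δ ^ 2)⁻¹) ^ 2 * hubIntegral (L := L) (hubAt δ 1) ε b) -
        Real.exp (CT₂ * (L : ℝ) ^ pT₂ - Real.sqrt b * τ ^ qT₂ / (QT₂ * (L : ℝ) ^ pT₂)) := fun L _ τ b ε => dif_neg (NeZero.ne L)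
  -- thresholds `(K+1)·L^k·τ⁻¹^k ≤ b` on a window `τ ≤ min τw ½ / L^kw` give `1 ≤ b` and `K·L^k·τ⁻¹^k ≤ b`
  have hthr : ∀ {K τw : ℝ} {k kw : ℕ} {L : ℕ} [NeZero L] {τ b : ℝ}, 0 < K → 0 < τw → 0 < τ → τ ≤ min τw (1 / 2) / (L : ℝ) ^ kw →
      (K + 1) * (L : ℝ) ^ k * τ⁻¹ ^ k ≤ b → 1 ≤ b ∧ K * (L : ℝ) ^ k * τ⁻¹ ^ k ≤ b ∧ τ ≤ τw / (L : ℝ) ^ kw ∧ τ ≤ 1 := by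
    intro K τw k kw L _ τ b hK hτw hτ hτle hb
    have hL1 : (1 : ℝ) ≤ L := by exact_mod_cast NeZero.one_le
    have hm0 : 0 ≤ min τw (1 / 2) := le_min hτw.le (by norm_num)
    have hτ2 : τ ≤ 1 / 2 := hτle.trans ((div_le_self hm0 (one_le_pow₀ hL1)).trans (min_le_right _ _))
    have hτ1 : τ ≤ 1 := by linarith
    have hτi1 : 1 ≤ τ⁻¹ := by rw [one_le_inv₀ hτ]; exact hτ1
    have hP : (1 : ℝ) ≤ (L : ℝ) ^ k * τ⁻¹ ^ k := by nlinarith [one_le_pow₀ (n := k) hL1, one_le_pow₀ (n := k) hτi1]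
    refine ⟨?_, ?_, ?_, hτ1⟩
    · nlinarith
    · nlinarith
    · exact hτle.trans (div_le_div_of_nonneg_right (min_le_left _ _) (by positivity))
  have hrate₁ : ∀ (L : ℕ) [NeZero L] (τ : ℝ), 0 < τ → τ ≤ min τw₁ (1 / 2) / (L : ℝ) ^ kw₁ → ∀ b : ℝ, (K₁ + 1) * (L : ℝ) ^ k₁ * τ⁻¹ ^ k₁ ≤ b →
      ∀ ε : GnoSign L, GoodSign ε → lhs₁ L τ b ε ≤ (C₁ * (L : ℝ) ^ c₁ * τ ^ γ₁ + D₁ * (L : ℝ) ^ d₁ * τ⁻¹ ^ d₁' * b ^ (-η₁)) * main L τ b ε := by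
    intro L _ τ hτ hτle b hb ε hε
    obtain ⟨hb1, hbK, hτw, -⟩ := hthr hK₁ hτw₁ hτ hτle hb
    have h := H₁ L τ hτ hτw b hbK ε hε
    rw [hlhs₁_eq, hmain_eq L τ b ε hb1]
    linarith
  have hrate₂ : ∀ (L : ℕ) [NeZero L] (τ : ℝ), 0 < τ → τ ≤ min τw₂ (1 / 2) / (L : ℝ) ^ kw₂ → ∀ b : ℝ, (K₂ + 1) * (L : ℝ) ^ k₂ * τ⁻¹ ^ k₂ ≤ b →
      ∀ ε : GnoSign L, GoodSign ε → lhs₂ L τ b ε ≤ (C₂ * (L : ℝ) ^ c₂ * τ ^ γ₂ + D₂ * (L : ℝ) ^ d₂ * τ⁻¹ ^ d₂' * b ^ (-η₂)) * main L τ b ε := by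
    intro L _ τ hτ hτle b hb ε hε
    obtain ⟨hb1, hbK, hτw, -⟩ := hthr hK₂ hτw₂ hτ hτle hb
    have h := H₂ L τ hτ hτw b hbK ε hε
    rw [hlhs₂_eq, hmain_eq L τ b ε hb1]
    linarith
  obtain ⟨KR₁, hKR₁, kR₁, τR₁, hτR₁, hτR₁2, HR₁⟩ := core_of_two_rates lhs₁ main hmain0 (q := 1 / 256) (by norm_num) hC₁ hD₁ hγ₁ hη₁
    (by linarith : 0 < K₁ + 1) (lt_min hτw₁ (by norm_num)) hrate₁
  obtain ⟨KR₂, hKR₂, kR₂, τR₂, hτR₂, hτR₂2, HR₂⟩ := core_of_two_rates lhs₂ main hmain0 (q := 1 / 256) (by norm_num) hC₂ hD₂ hγ₂ hη₂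
    (by linarith : 0 < K₂ + 1) (lt_min hτw₂ (by norm_num)) hrate₂
  -- merged thresholds
  have hKsum : 0 < KR₁ + KR₂ + KA + KB + 1 := by linarith
  refine ⟨KR₁ + KR₂ + KA + KB + 1, hKsum, kR₁ + kR₂ + kA + kB, min τR₁ τR₂, lt_min hτR₁ hτR₂, (min_le_left _ _).trans hτR₁2,
    fun L _ τ hτ hτle b hb ε hε => ?_⟩
  have hL1 : (1 : ℝ) ≤ L := by exact_mod_cast NeZero.one_le
  set k : ℕ := kR₁ + kR₂ + kA + kB with hk
  have hLk : (1 : ℝ) ≤ (L : ℝ) ^ k := one_le_pow₀ hL1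
  have hτ2 : τ ≤ 1 / 2 := hτle.trans ((div_le_self (lt_min hτR₁ hτR₂).le hLk).trans ((min_le_left _ _).trans hτR₁2))
  have hτ1 : τ ≤ 1 := by linarith
  have hτi1 : 1 ≤ τ⁻¹ := by rw [one_le_inv₀ hτ]; exact hτ1
  have hτR₁' : τ ≤ τR₁ / (L : ℝ) ^ kR₁ :=
    hτle.trans (div_le_div₀ hτR₁.le (min_le_left _ _) (by positivity) (pow_le_pow_right₀ hL1 (by omega)))
  have hτR₂' : τ ≤ τR₂ / (L : ℝ) ^ kR₂ :=
    hτle.trans (div_le_div₀ hτR₂.le (min_le_right _ _) (by positivity) (pow_le_pow_right₀ hL1 (by omega)))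
  have hmono : ∀ {K' : ℝ} {k' : ℕ}, 0 < K' → K' ≤ KR₁ + KR₂ + KA + KB + 1 → k' ≤ k → K' * (L : ℝ) ^ k' * τ⁻¹ ^ k' ≤ b := by
    intro K' k' hK' hK'le hk'
    calc K' * (L : ℝ) ^ k' * τ⁻¹ ^ k' ≤ (KR₁ + KR₂ + KA + KB + 1) * (L : ℝ) ^ k * τ⁻¹ ^ k :=
          mul_le_mul (mul_le_mul hK'le (pow_le_pow_right₀ hL1 hk') (by positivity) hKsum.le) (pow_le_pow_right₀ hτi1 hk') (by positivity)
            (mul_nonneg hKsum.le (by positivity))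
      _ ≤ b := hb
  have hbR₁ : KR₁ * (L : ℝ) ^ kR₁ * τ⁻¹ ^ kR₁ ≤ b := hmono hKR₁ (by linarith) (by omega)
  have hbR₂ : KR₂ * (L : ℝ) ^ kR₂ * τ⁻¹ ^ kR₂ ≤ b := hmono hKR₂ (by linarith) (by omega)
  have hbA : KA * (L : ℝ) ^ kA * τ⁻¹ ^ kA ≤ b := hmono hKA (by linarith) (by omega)
  have hbB : KB * (L : ℝ) ^ kB * τ⁻¹ ^ kB ≤ b := hmono hKB (by linarith) (by omega)
  have hb1 : 1 ≤ b := by have h := hmono one_pos (by linarith) (Nat.zero_le k); simpa using h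
  have hb0 : 0 < b := by linarith
  -- the four pieces
  have h1 := HR₁ L τ hτ hτR₁' b hbR₁ ε hε
  have h2 := HR₂ L τ hτ hτR₂' b hbR₂ ε hε
  rw [hlhs₁_eq, hmain_eq L τ b ε hb1] at h1
  rw [hlhs₂_eq, hmain_eq L τ b ε hb1] at h2
  have h3 := HA L ε hε τ hτ hτ2 b hbA
  have h4 := HB L ε hε τ hτ hτ2 b hbB
  -- the window in the letter `δ`, split
  rw [tipWindow_eq_integral_hubIntegral ε τ hb0.le, tipWindow_split ε hτ1 hb0.le, mul_add, mul_add]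
  linarith

/-- ★★★ **`stub_core_tip` OF SKELETON ➎ v14 VERBATIM FROM THE TWO HALF-WINDOW BOUNDS** (✓`stub_core_tip_of_tipBound` ∘ ✓`tipBound_of_halves`). [cite: Luscher1983, §2] -/
theorem stub_core_tip_of_halves
    (hpos : ∃ C : ℝ, 0 < C ∧ ∃ c : ℕ, ∃ γ : ℝ, 0 < γ ∧ ∃ D : ℝ, 0 ≤ D ∧ ∃ d d' : ℕ, ∃ η : ℝ, 0 < η ∧
      ∃ CT : ℝ, ∃ pT : ℕ, ∃ QT : ℝ, 0 < QT ∧ ∃ qT : ℕ, ∃ K₁ : ℝ, 0 < K₁ ∧ ∃ k₁ : ℕ, ∃ τw : ℝ, 0 < τw ∧ ∃ kw : ℕ,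
      ∀ (L : ℕ) [NeZero L] (τ : ℝ), 0 < τ → τ ≤ τw / (L : ℝ) ^ kw → ∀ b : ℝ, K₁ * (L : ℝ) ^ k₁ * τ⁻¹ ^ k₁ ≤ b → ∀ ε : GnoSign L, GoodSign ε →
        stiffKappa L (1 / 8) * (coneConst * Real.pi *
          ∫ δ in {δ : ℝ | (1 + δ ^ 2)⁻¹ < τ ∧ 0 < δ}, ((1 + δ ^ 2)⁻¹) ^ 2 * hubIntegral (L := L) (hubAt δ 1) ε b) ≤
          (C * (L : ℝ) ^ c * τ ^ γ + D * (L : ℝ) ^ d * τ⁻¹ ^ d' * b ^ (-η)) *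
              ((2 * Real.pi / b) ^ alpha L * ∫ a in HubBulk τ, (∫ p : ℝ × ℝ, mbDensity (L := L) a ε p) ∂coneMeasure) +
            Real.exp (CT * (L : ℝ) ^ pT - Real.sqrt b * τ ^ qT / (QT * (L : ℝ) ^ pT)))
    (hneg : ∃ C : ℝ, 0 < C ∧ ∃ c : ℕ, ∃ γ : ℝ, 0 < γ ∧ ∃ D : ℝ, 0 ≤ D ∧ ∃ d d' : ℕ, ∃ η : ℝ, 0 < η ∧
      ∃ CT : ℝ, ∃ pT : ℕ, ∃ QT : ℝ, 0 < QT ∧ ∃ qT : ℕ, ∃ K₁ : ℝ, 0 < K₁ ∧ ∃ k₁ : ℕ, ∃ τw : ℝ, 0 < τw ∧ ∃ kw : ℕ,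
      ∀ (L : ℕ) [NeZero L] (τ : ℝ), 0 < τ → τ ≤ τw / (L : ℝ) ^ kw → ∀ b : ℝ, K₁ * (L : ℝ) ^ k₁ * τ⁻¹ ^ k₁ ≤ b → ∀ ε : GnoSign L, GoodSign ε →
        stiffKappa L (1 / 8) * (coneConst * Real.pi *
          ∫ δ in {δ : ℝ | (1 + δ ^ 2)⁻¹ < τ ∧ δ < 0}, ((1 + δ ^ 2)⁻¹) ^ 2 * hubIntegral (L := L) (hubAt δ 1) ε b) ≤
          (C * (L : ℝ) ^ c * τ ^ γ + D * (L : ℝ) ^ d * τ⁻¹ ^ d' * b ^ (-η)) *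
              ((2 * Real.pi / b) ^ alpha L * ∫ a in HubBulk τ, (∫ p : ℝ × ℝ, mbDensity (L := L) a ε p) ∂coneMeasure) +
            Real.exp (CT * (L : ℝ) ^ pT - Real.sqrt b * τ ^ qT / (QT * (L : ℝ) ^ pT))) :
    ∃ K : ℝ, 0 < K ∧ ∃ k : ℕ, ∃ τ₀ : ℝ, 0 < τ₀ ∧ τ₀ ≤ 1 / 2 ∧ ∀ (L : ℕ) [NeZero L] (τ : ℝ), 0 < τ → τ ≤ τ₀ / (L : ℝ) ^ k →
      ∀ b : ℝ, K * (L : ℝ) ^ k * τ⁻¹ ^ k ≤ b →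
        stiffKappa L (1 / 8) * ∑ ε ∈ (Finset.univ.filter fun ε : GnoSign L => GoodSign ε),
            ∫ x in TipHub τ ×ˢ (univ : Set (GnoCoord L)), Real.exp (-(b * gnoDeficit z₀ (fun _ => 1) x.1 ε x.2)) ∂chartMeasure L ≤
          (1 / 32 : ℝ) * ∑ ε ∈ (Finset.univ.filter fun ε : GnoSign L => GoodSign ε), ∫ a in HubBulk τ, hubIntegral a ε b ∂coneMeasure :=
  stub_core_tip_of_tipBound (tipBound_of_halves hpos hneg)

end Summit.QuantumFields.YangMills.Theorems.SwapVirialDeficit.SectorLaplace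

end
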